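import Summits.ABC.ABC.Theses.IneffectiveSubspace
import Summits.ABC.ABC.Theorems.TowerExponentWindow.Negative.TowerExponentWindowFloors
import Literature.NumberTheory.DiophantineGeometry.AbcImpliesHall

/-!
# `TowerExponentWindow` (stmt-ABC-1647) — negative-side lemmas III: load-bearing hypotheses of the three
stubs of line `binomial-xi-d-zero-threefold`

Deep-refute (drefute) output for the registered skeleton
`Cruxes/TowerExponentWindow/Lines/binomial-xi-d-zero-threefold.lean` (stubs `stub_binomialDepthWindow` = A, the
lever; `stub_flatBoundOfDepth` = B, the dictionary; `stub_polyAbcOfFlatBound` = C, the lift).  No stub is false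
(A is abc-sandwiched, skeleton `binomialDepthWindow_of_abc`; B and C are bookkeeping); recorded here, with every
statement spelled out verbatim (no auxiliary definitions), is WHICH HYPOTHESIS OF WHICH STUB CARRIES CONTENT:

Stub A, `∃ n C C', 0 ≤ C ∧ 3C < n ∧ Depth(n, C, C')`:
* `depth_trivial`, `depth_without_window` — with the window `3C < n` dropped the stub is TRIVIALLY TRUE
  (`Depth(n, n, 0)` for every `n ≥ 1`: a divisor of `a₁a₂ⁿ − c₁c₂ⁿ ≠ 0` is at most `max(a₁,c₁)·max(a₂,c₂)ⁿ`,
  `divisor_le_heights`).  All content of the lever sits in the window, exactly as for the crux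
  (`towerExponentWindow_without_window` in `Cruxes/…/Disproof.lean`).
* `le_of_depth_without_coprime`, `not_depth_window_without_coprime` — with `Nat.Coprime (a₁a₂) (c₁c₂)` dropped,
  `Depth` forces `C ≥ n` (family `1·(2^(m+2))ⁿ − 1·(2^(m+1))ⁿ`, `d = 2^(n(m+1))`), so no window `λC < n`, `λ ≥ 1`,
  survives: coprimality is load-bearing.
* `not_depth_without_ne` — with `a₁a₂ⁿ ≠ c₁c₂ⁿ` dropped the matrix is FALSE for every `(n, C, C')` (data
  `(1,1,1,1)`, `d = 2^m ∣ 0`); given coprimality that hypothesis only excludes `(1,1,1,1)`.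
* `depth_nonneg`, `depth_iff_without_dpos` — `0 ≤ C` and `0 < d` are DECORATIVE (implied by the matrix).
* companion file `StubBinomialDepthWindowEvenFloor.lean`: floor `C ≥ 2` at EVERY EVEN level (family
  `d = 3^k·5^l = a₂² − c₂²`), extending the landed floors at `4 ∣ n`, `6 ∣ n` to `n ≡ 2 (mod 4)`.

Stub B, `∀ n C C', 0 ≤ C → 3C < n → Depth(n, C, C') → Flat(n)`:
* `not_flat_one`, `not_flat_two` — `Flat(1)`, `Flat(2)` are false (`t + 1 = (t+1)`; Pell `1 + 3Y² = X²`), so B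
  (and C) are vacuous there; with the landed `four_le_of_depth_window` … `seven_le`, B has content only at `n ≥ 7`.
* `not_flatOfDepth_window_le` — the window of B cannot be weakened to `C ≤ n` (`n = 1`, `C = 1`, `C' = 0`:
  `Depth(1,1,0)` holds, `Flat(1)` fails).  (It CAN be strengthened to `2C < n`: Disproof.lean (d), mutation note.)

Stub C, `∀ n, 1 ≤ n → Flat(n) → PolyABC`:
* `flat_zero`, `polyOfFlat_without_level_iff` — with `1 ≤ n` dropped the stub is EQUIVALENT to polynomial abc
  itself (`Flat(0)` is trivially true), i.e. to the crux (`towerExponentWindow_iff_polyAbc`): the level hypothesis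
  is what keeps C from being the crux in costume.

Refuter seat drefute-stmt-ABC-1647 (2026-08-16); notes `Cruxes/TowerExponentWindow/Negative-notes/`.
-/

namespace Summit.ABC.ABC.Theorems.TowerExponentWindow.Negative

open Literature.NumberTheory.DiophantineGeometry (radical_le_of_dvd_pow IsABCTriple rad)

/-! ## Stub A: the window carries all the content -/

/-- A positive divisor (in `ℤ`) of `a₁a₂ⁿ − c₁c₂ⁿ ≠ 0` is at most `max(a₁,c₁)·max(a₂,c₂)ⁿ`. [folklore] -/
theorem divisor_le_heights {n a₁ a₂ c₁ c₂ d : ℕ} (hne : a₁ * a₂ ^ n ≠ c₁ * c₂ ^ n)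
    (hdvd : (d : ℤ) ∣ ((a₁ * a₂ ^ n : ℕ) : ℤ) - ((c₁ * c₂ ^ n : ℕ) : ℤ)) :
    d ≤ max a₁ c₁ * (max a₂ c₂) ^ n := by
  rcases Nat.lt_or_gt_of_ne hne with hlt | hlt
  · have h1 : (d : ℤ) ∣ ((c₁ * c₂ ^ n - a₁ * a₂ ^ n : ℕ) : ℤ) := by
      rw [Nat.cast_sub hlt.le]; exact dvd_sub_comm.mp hdvd
    have h2 : d ∣ c₁ * c₂ ^ n - a₁ * a₂ ^ n := Int.natCast_dvd_natCast.mp h1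
    calc d ≤ c₁ * c₂ ^ n - a₁ * a₂ ^ n := Nat.le_of_dvd (Nat.sub_pos_of_lt hlt) h2
      _ ≤ c₁ * c₂ ^ n := Nat.sub_le _ _
      _ ≤ max a₁ c₁ * (max a₂ c₂) ^ n :=
          Nat.mul_le_mul (le_max_right _ _) (Nat.pow_le_pow_left (le_max_right _ _) _)
  · have h1 : (d : ℤ) ∣ ((a₁ * a₂ ^ n - c₁ * c₂ ^ n : ℕ) : ℤ) := by
      rw [Nat.cast_sub hlt.le]; exact hdvd
    have h2 : d ∣ a₁ * a₂ ^ n - c₁ * c₂ ^ n := Int.natCast_dvd_natCast.mp h1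
    calc d ≤ a₁ * a₂ ^ n - c₁ * c₂ ^ n := Nat.le_of_dvd (Nat.sub_pos_of_lt hlt) h2
      _ ≤ a₁ * a₂ ^ n := Nat.sub_le _ _
      _ ≤ max a₁ c₁ * (max a₂ c₂) ^ n :=
          Nat.mul_le_mul (le_max_left _ _) (Nat.pow_le_pow_left (le_max_left _ _) _)

/-- **Stub A's matrix holds trivially with `C = n`, `C' = 0`** (`n ≥ 1`): `log d ≤ log max₁ + n·log max₂`.
[folklore] -/
theorem depth_trivial {n : ℕ} (hn : 1 ≤ n) :
    ∀ a₁ a₂ c₁ c₂ : ℕ, 0 < a₁ → 0 < a₂ → 0 < c₁ → 0 < c₂ → Nat.Coprime (a₁ * a₂) (c₁ * c₂) →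
      a₁ * a₂ ^ n ≠ c₁ * c₂ ^ n → ∀ d : ℕ, 0 < d → (d : ℤ) ∣ ((a₁ * a₂ ^ n : ℕ) : ℤ) - ((c₁ * c₂ ^ n : ℕ) : ℤ) →
      Real.log (d : ℝ) ≤ (n : ℝ) * (Real.log ((max a₁ c₁ : ℕ) : ℝ) + Real.log ((max a₂ c₂ : ℕ) : ℝ) +
        Real.log ((UniqueFactorizationMonoid.radical d : ℕ) : ℝ)) + 0 := by
  intro a₁ a₂ c₁ c₂ ha₁ ha₂ _ _ _ hne d hd hdvd
  have hle := divisor_le_heights hne hdvd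
  have hM₁ : (1 : ℝ) ≤ ((max a₁ c₁ : ℕ) : ℝ) := by exact_mod_cast le_max_of_le_left ha₁
  have hM₂ : (1 : ℝ) ≤ ((max a₂ c₂ : ℕ) : ℝ) := by exact_mod_cast le_max_of_le_left ha₂
  have hlog : Real.log (d : ℝ) ≤ Real.log ((max a₁ c₁ : ℕ) : ℝ) + n * Real.log ((max a₂ c₂ : ℕ) : ℝ) := by
    have h1 : (d : ℝ) ≤ ((max a₁ c₁ : ℕ) : ℝ) * ((max a₂ c₂ : ℕ) : ℝ) ^ n := by exact_mod_cast hle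
    have h2 := Real.log_le_log (by exact_mod_cast hd) h1
    rwa [Real.log_mul (by positivity) (by positivity), Real.log_pow] at h2
  have h1 : 0 ≤ Real.log ((max a₁ c₁ : ℕ) : ℝ) := Real.log_nonneg hM₁
  have h3 : 0 ≤ Real.log ((UniqueFactorizationMonoid.radical d : ℕ) : ℝ) :=
    Real.log_nonneg (by exact_mod_cast Nat.radical_pos d)
  have hn' : (1 : ℝ) ≤ n := by exact_mod_cast hn
  have h4 : Real.log ((max a₁ c₁ : ℕ) : ℝ) ≤ n * Real.log ((max a₁ c₁ : ℕ) : ℝ) :=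
    le_mul_of_one_le_left h1 hn'
  have h5 : 0 ≤ (n : ℝ) * Real.log ((UniqueFactorizationMonoid.radical d : ℕ) : ℝ) := by positivity
  linarith

/-- **Stub A with the window `3C < n` dropped is TRUE** (witness `n = 1`, `C = 1`, `C' = 0`): the window carries
all the content of the lever. [folklore] -/
theorem depth_without_window :
    ∃ n : ℕ, ∃ C C' : ℝ, 0 ≤ C ∧ ∀ a₁ a₂ c₁ c₂ : ℕ, 0 < a₁ → 0 < a₂ → 0 < c₁ → 0 < c₂ →
      Nat.Coprime (a₁ * a₂) (c₁ * c₂) → a₁ * a₂ ^ n ≠ c₁ * c₂ ^ n → ∀ d : ℕ, 0 < d →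
      (d : ℤ) ∣ ((a₁ * a₂ ^ n : ℕ) : ℤ) - ((c₁ * c₂ ^ n : ℕ) : ℤ) →
      Real.log (d : ℝ) ≤ C * (Real.log ((max a₁ c₁ : ℕ) : ℝ) + Real.log ((max a₂ c₂ : ℕ) : ℝ) +
        Real.log ((UniqueFactorizationMonoid.radical d : ℕ) : ℝ)) + C' :=
  ⟨1, ((1 : ℕ) : ℝ), 0, Nat.cast_nonneg 1, depth_trivial le_rfl⟩

/-! ## Stub A: coprimality and `≠` are load-bearing; `0 ≤ C`, `0 < d` are decorative -/

/-- Real-arithmetic kernel of the floor arguments: `p·s ≤ C(q·s + r) + C'` along an unbounded `s` forces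
`p ≤ C·q`. [folklore] -/
theorem floor_of_unbounded {C C' p q r : ℝ} (s : ℕ → ℝ) (hunb : ∀ K : ℝ, ∃ m, K ≤ s m)
    (h : ∀ m, p * s m ≤ C * (q * s m + r) + C') : p ≤ C * q := by
  by_contra hlt
  have hg : 0 < p - C * q := by linarith [lt_of_not_ge hlt]
  obtain ⟨m, hm⟩ := hunb ((C * r + C' + 1) / (p - C * q))
  have h2 := h m
  have h4 : C * r + C' + 1 ≤ (p - C * q) * s m := by
    have := (div_le_iff₀ hg).mp hm
    linarith
  nlinarith

/-- **Without coprimality the depth inequality forces `C ≥ n`**: the data `a₁ = c₁ = 1`, `a₂ = 2^(m+2)`,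
`c₂ = 2^(m+1)`, `d = 2^(n(m+1)) ∣ a₂ⁿ − c₂ⁿ` have depth `n(m+1) log 2` against heights `0 + (m+2) log 2 + log 2`.
(With `C = n` it holds trivially, `depth_trivial` without its unused coprimality hypothesis.) [folklore] -/
theorem le_of_depth_without_coprime {n : ℕ} {C C' : ℝ} (hC : 0 ≤ C)
    (h : ∀ a₁ a₂ c₁ c₂ : ℕ, 0 < a₁ → 0 < a₂ → 0 < c₁ → 0 < c₂ →
      a₁ * a₂ ^ n ≠ c₁ * c₂ ^ n → ∀ d : ℕ, 0 < d → (d : ℤ) ∣ ((a₁ * a₂ ^ n : ℕ) : ℤ) - ((c₁ * c₂ ^ n : ℕ) : ℤ) →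
      Real.log (d : ℝ) ≤ C * (Real.log ((max a₁ c₁ : ℕ) : ℝ) + Real.log ((max a₂ c₂ : ℕ) : ℝ) +
        Real.log ((UniqueFactorizationMonoid.radical d : ℕ) : ℝ)) + C') :
    (n : ℝ) ≤ C := by
  rcases Nat.eq_zero_or_pos n with rfl | hn
  · simpa using hC
  have hlog2 : 0 < Real.log 2 := Real.log_pos one_lt_two
  have key := floor_of_unbounded (C := C) (C' := C') (p := n) (q := 1) (r := 2 * Real.log 2)
    (fun m => ((m : ℝ) + 1) * Real.log 2) (fun K => ?_) (fun m => ?_)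
  · linarith
  · obtain ⟨m, hm⟩ := exists_nat_ge (K / Real.log 2)
    refine ⟨m, ?_⟩
    have := (div_le_iff₀ hlog2).mp hm
    nlinarith
  · -- the data at parameter `m`
    have hpow : 2 ^ (n * (m + 1)) ≤ 2 ^ (n * (m + 2)) := Nat.pow_le_pow_right two_pos (by nlinarith)
    have hne : 1 * (2 ^ (m + 2)) ^ n ≠ 1 * (2 ^ (m + 1)) ^ n := by
      rw [one_mul, one_mul, ← pow_mul, ← pow_mul]
      intro he
      have := Nat.pow_right_injective le_rfl he
      have : (m + 2) * n = (m + 1) * n := this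
      have hn0 : 0 < n := hn
      nlinarith
    have hdvd : ((2 ^ (n * (m + 1)) : ℕ) : ℤ) ∣ ((1 * (2 ^ (m + 2)) ^ n : ℕ) : ℤ) - ((1 * (2 ^ (m + 1)) ^ n : ℕ) : ℤ) := by
      have h1 : 2 ^ (n * (m + 1)) ∣ 1 * (2 ^ (m + 2)) ^ n - 1 * (2 ^ (m + 1)) ^ n := by
        rw [one_mul, one_mul, ← pow_mul, ← pow_mul, mul_comm (m + 2), mul_comm (m + 1)]
        exact Nat.dvd_sub (Nat.pow_dvd_pow 2 (by nlinarith)) dvd_rfl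
      have hle : 1 * (2 ^ (m + 1)) ^ n ≤ 1 * (2 ^ (m + 2)) ^ n := by
        rw [one_mul, one_mul, ← pow_mul, ← pow_mul, mul_comm (m + 1), mul_comm (m + 2)]; exact hpow
      have := Int.natCast_dvd_natCast.mpr h1
      rwa [Nat.cast_sub hle] at this
    have h1 := h 1 (2 ^ (m + 2)) 1 (2 ^ (m + 1)) one_pos (by positivity) one_pos (by positivity) hne
      (2 ^ (n * (m + 1))) (by positivity) hdvd
    -- evaluate the logarithms
    have e1 : (max (2 ^ (m + 2)) (2 ^ (m + 1)) : ℕ) = 2 ^ (m + 2) :=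
      max_eq_left (Nat.pow_le_pow_right two_pos (by omega))
    rw [max_self, e1] at h1
    have hrad : UniqueFactorizationMonoid.radical (2 ^ (n * (m + 1))) ≤ 2 :=
      radical_le_of_dvd_pow (n := n * (m + 1)) two_ne_zero dvd_rfl
    have hrad' : Real.log ((UniqueFactorizationMonoid.radical (2 ^ (n * (m + 1))) : ℕ) : ℝ) ≤ Real.log 2 :=
      Real.log_le_log (by exact_mod_cast Nat.radical_pos _) (by exact_mod_cast hrad)
    have hd : Real.log ((2 ^ (n * (m + 1)) : ℕ) : ℝ) = (n : ℝ) * (((m : ℝ) + 1) * Real.log 2) := by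
      push_cast; rw [Real.log_pow]; push_cast; ring
    have ha : Real.log ((2 ^ (m + 2) : ℕ) : ℝ) = ((m : ℝ) + 2) * Real.log 2 := by
      push_cast; rw [Real.log_pow]; push_cast; ring
    rw [hd, ha, Nat.cast_one, Real.log_one, zero_add] at h1
    have hmono : C * (((m : ℝ) + 2) * Real.log 2 +
        Real.log ((UniqueFactorizationMonoid.radical (2 ^ (n * (m + 1))) : ℕ) : ℝ)) ≤
        C * (1 * (((m : ℝ) + 1) * Real.log 2) + 2 * Real.log 2) := by
      refine mul_le_mul_of_nonneg_left ?_ hC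
      linarith
    linarith

/-- **Coprimality is load-bearing for stub A**: without it no window `3C < n` (indeed no `C < n`) is possible.
[folklore] -/
theorem not_depth_window_without_coprime :
    ¬ ∃ n : ℕ, ∃ C C' : ℝ, 0 ≤ C ∧ 3 * C < n ∧ ∀ a₁ a₂ c₁ c₂ : ℕ, 0 < a₁ → 0 < a₂ → 0 < c₁ → 0 < c₂ →
      a₁ * a₂ ^ n ≠ c₁ * c₂ ^ n → ∀ d : ℕ, 0 < d → (d : ℤ) ∣ ((a₁ * a₂ ^ n : ℕ) : ℤ) - ((c₁ * c₂ ^ n : ℕ) : ℤ) →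
      Real.log (d : ℝ) ≤ C * (Real.log ((max a₁ c₁ : ℕ) : ℝ) + Real.log ((max a₂ c₂ : ℕ) : ℝ) +
        Real.log ((UniqueFactorizationMonoid.radical d : ℕ) : ℝ)) + C' := by
  rintro ⟨n, C, C', hC, h3, h⟩
  have := le_of_depth_without_coprime hC h
  linarith

/-- **The hypothesis `a₁a₂ⁿ ≠ c₁c₂ⁿ` is load-bearing** (through the single datum `(1,1,1,1)`, where every
`d = 2^m` divides `0`): without it the matrix fails for every `(n, C, C')`. [folklore] -/
theorem not_depth_without_ne (n : ℕ) (C C' : ℝ) :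
    ¬ ∀ a₁ a₂ c₁ c₂ : ℕ, 0 < a₁ → 0 < a₂ → 0 < c₁ → 0 < c₂ → Nat.Coprime (a₁ * a₂) (c₁ * c₂) →
      ∀ d : ℕ, 0 < d → (d : ℤ) ∣ ((a₁ * a₂ ^ n : ℕ) : ℤ) - ((c₁ * c₂ ^ n : ℕ) : ℤ) →
      Real.log (d : ℝ) ≤ C * (Real.log ((max a₁ c₁ : ℕ) : ℝ) + Real.log ((max a₂ c₂ : ℕ) : ℝ) +
        Real.log ((UniqueFactorizationMonoid.radical d : ℕ) : ℝ)) + C' := by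
  intro h
  have hlog2 : 0 < Real.log 2 := Real.log_pos one_lt_two
  have key : ∀ m : ℕ, ((m : ℝ) + 1) * Real.log 2 ≤ |C| * Real.log 2 + C' := by
    intro m
    have h1 := h 1 1 1 1 one_pos one_pos one_pos one_pos (by simp) (2 ^ (m + 1)) (by positivity) (by simp)
    have hrad : UniqueFactorizationMonoid.radical (2 ^ (m + 1)) ≤ 2 :=
      radical_le_of_dvd_pow (n := m + 1) two_ne_zero dvd_rfl
    have hr1 : 0 ≤ Real.log ((UniqueFactorizationMonoid.radical (2 ^ (m + 1)) : ℕ) : ℝ) :=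
      Real.log_nonneg (by exact_mod_cast Nat.radical_pos _)
    have hr2 : Real.log ((UniqueFactorizationMonoid.radical (2 ^ (m + 1)) : ℕ) : ℝ) ≤ Real.log 2 :=
      Real.log_le_log (by exact_mod_cast Nat.radical_pos _) (by exact_mod_cast hrad)
    have hd : Real.log ((2 ^ (m + 1) : ℕ) : ℝ) = ((m : ℝ) + 1) * Real.log 2 := by
      push_cast; rw [Real.log_pow]; push_cast; ring
    rw [hd, max_self, Nat.cast_one, Real.log_one, zero_add, zero_add] at h1
    have hC : C * Real.log ((UniqueFactorizationMonoid.radical (2 ^ (m + 1)) : ℕ) : ℝ) ≤ |C| * Real.log 2 :=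
      calc C * Real.log ((UniqueFactorizationMonoid.radical (2 ^ (m + 1)) : ℕ) : ℝ)
          ≤ |C| * Real.log ((UniqueFactorizationMonoid.radical (2 ^ (m + 1)) : ℕ) : ℝ) :=
            mul_le_mul_of_nonneg_right (le_abs_self C) hr1
        _ ≤ |C| * Real.log 2 := mul_le_mul_of_nonneg_left hr2 (abs_nonneg C)
    linarith
  obtain ⟨m, hm⟩ := exists_nat_gt ((|C| * Real.log 2 + C') / Real.log 2)
  have h1 := key m
  have h2 := (div_lt_iff₀ hlog2).mp hm
  nlinarith

/-- **`0 ≤ C` is decorative**: the matrix already forces it (data `a₁ = N + 2`, `a₂ = c₁ = c₂ = 1`, `d = 1`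
give `0 ≤ C·log(N+2) + C'` for all `N`). [folklore] -/
theorem depth_nonneg {n : ℕ} {C C' : ℝ}
    (h : ∀ a₁ a₂ c₁ c₂ : ℕ, 0 < a₁ → 0 < a₂ → 0 < c₁ → 0 < c₂ → Nat.Coprime (a₁ * a₂) (c₁ * c₂) →
      a₁ * a₂ ^ n ≠ c₁ * c₂ ^ n → ∀ d : ℕ, 0 < d → (d : ℤ) ∣ ((a₁ * a₂ ^ n : ℕ) : ℤ) - ((c₁ * c₂ ^ n : ℕ) : ℤ) →
      Real.log (d : ℝ) ≤ C * (Real.log ((max a₁ c₁ : ℕ) : ℝ) + Real.log ((max a₂ c₂ : ℕ) : ℝ) +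
        Real.log ((UniqueFactorizationMonoid.radical d : ℕ) : ℝ)) + C') :
    0 ≤ C := by
  by_contra hC
  push Not at hC
  have key : ∀ N : ℕ, 0 ≤ C * Real.log ((N : ℝ) + 2) + C' := by
    intro N
    have h1 := h (N + 2) 1 1 1 (by omega) one_pos one_pos one_pos (by simp) (by simp) 1 one_pos (by simp)
    have e1 : (max (N + 2) 1 : ℕ) = N + 2 := max_eq_left (by omega)
    rw [e1, max_self, Nat.cast_one, Real.log_one] at h1
    have hr : UniqueFactorizationMonoid.radical (1 : ℕ) = 1 := UniqueFactorizationMonoid.radical_one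
    rw [hr, Nat.cast_one, Real.log_one, add_zero, add_zero] at h1
    push_cast at h1
    exact h1
  obtain ⟨N, hN⟩ := exists_nat_gt (Real.exp ((C' + 1) / (-C)))
  have hpos : (0 : ℝ) < (N : ℝ) + 2 := by positivity
  have hlog : (C' + 1) / (-C) < Real.log ((N : ℝ) + 2) := by
    rw [Real.lt_log_iff_exp_lt hpos]; linarith
  have hnegC : 0 < -C := by linarith
  have h2 : C' + 1 < -C * Real.log ((N : ℝ) + 2) := by
    have := (div_lt_iff₀ hnegC).mp hlog
    linarith
  have := key N
  linarith

/-- **`0 < d` is decorative**: a divisor `d = 0` would force `a₁a₂ⁿ = c₁c₂ⁿ`. [folklore] -/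
theorem depth_iff_without_dpos (n : ℕ) (C C' : ℝ) :
    (∀ a₁ a₂ c₁ c₂ : ℕ, 0 < a₁ → 0 < a₂ → 0 < c₁ → 0 < c₂ → Nat.Coprime (a₁ * a₂) (c₁ * c₂) →
      a₁ * a₂ ^ n ≠ c₁ * c₂ ^ n → ∀ d : ℕ, 0 < d → (d : ℤ) ∣ ((a₁ * a₂ ^ n : ℕ) : ℤ) - ((c₁ * c₂ ^ n : ℕ) : ℤ) →
      Real.log (d : ℝ) ≤ C * (Real.log ((max a₁ c₁ : ℕ) : ℝ) + Real.log ((max a₂ c₂ : ℕ) : ℝ) +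
        Real.log ((UniqueFactorizationMonoid.radical d : ℕ) : ℝ)) + C') ↔
    (∀ a₁ a₂ c₁ c₂ : ℕ, 0 < a₁ → 0 < a₂ → 0 < c₁ → 0 < c₂ → Nat.Coprime (a₁ * a₂) (c₁ * c₂) →
      a₁ * a₂ ^ n ≠ c₁ * c₂ ^ n → ∀ d : ℕ, (d : ℤ) ∣ ((a₁ * a₂ ^ n : ℕ) : ℤ) - ((c₁ * c₂ ^ n : ℕ) : ℤ) →
      Real.log (d : ℝ) ≤ C * (Real.log ((max a₁ c₁ : ℕ) : ℝ) + Real.log ((max a₂ c₂ : ℕ) : ℝ) +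
        Real.log ((UniqueFactorizationMonoid.radical d : ℕ) : ℝ)) + C') := by
  constructor
  · intro h a₁ a₂ c₁ c₂ ha₁ ha₂ hc₁ hc₂ hcop hne d hdvd
    rcases Nat.eq_zero_or_pos d with rfl | hd
    · exfalso
      rw [Nat.cast_zero, zero_dvd_iff, sub_eq_zero] at hdvd
      exact hne (by exact_mod_cast hdvd)
    · exact h a₁ a₂ c₁ c₂ ha₁ ha₂ hc₁ hc₂ hcop hne d hd hdvd
  · intro h a₁ a₂ c₁ c₂ ha₁ ha₂ hc₁ hc₂ hcop hne d _ hdvd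
    exact h a₁ a₂ c₁ c₂ ha₁ ha₂ hc₁ hc₂ hcop hne d hdvd

/-! ## Stubs B and C: where they are vacuous, and their load-bearing side conditions -/

/-- **`Flat(1)` is false** (`(t + 1) + 1 = (t + 2)` with `u = v = w = 1`: `t + 2 ≤ K`): stubs B and C are vacuous at
level `1`. [folklore] -/
theorem not_flat_one :
    ¬ ∃ κ K : ℝ, ∀ u v w X Y Z : ℕ, 0 < u → 0 < v → 0 < w → 0 < X → 0 < Y → 0 < Z →
      u * X ^ 1 + v * Y ^ 1 = w * Z ^ 1 → Nat.Coprime (u * X ^ 1) (v * Y ^ 1) →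
      ((w * Z ^ 1 : ℕ) : ℝ) ≤ K * ((u * v * w : ℕ) : ℝ) ^ κ := by
  rintro ⟨κ, K, h⟩
  obtain ⟨t, ht⟩ := exists_nat_gt K
  have h1 := h 1 1 1 (t + 1) 1 (t + 2) one_pos one_pos one_pos (by omega) one_pos (by omega) (by ring) (by simp)
  push_cast at h1
  simp only [Real.one_rpow, one_mul, pow_one, mul_one] at h1
  linarith

/-- **`Flat(2)` is false** (Pell: `1·1² + 3·Y² = 1·X²` with `X² − 3Y² = 1`, `X` unbounded, `uvw = 3`): stubs B
and C are vacuous at level `2`.  (Level `3` is vacuous too — positive points of the rank-one cubic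
`X³ + Y³ = 9Z³` — but that is not formalised here.) [folklore] -/
theorem not_flat_two :
    ¬ ∃ κ K : ℝ, ∀ u v w X Y Z : ℕ, 0 < u → 0 < v → 0 < w → 0 < X → 0 < Y → 0 < Z →
      u * X ^ 2 + v * Y ^ 2 = w * Z ^ 2 → Nat.Coprime (u * X ^ 2) (v * Y ^ 2) →
      ((w * Z ^ 2 : ℕ) : ℝ) ≤ K * ((u * v * w : ℕ) : ℝ) ^ κ := by
  rintro ⟨κ, K, h⟩
  obtain ⟨k, hk⟩ := exists_nat_gt (K * (3 : ℝ) ^ κ)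
  have hy : 0 < Pell.yn Nat.one_lt_two (k + 1) := Pell.strictMono_y Nat.one_lt_two (Nat.succ_pos k)
  have hx : k + 1 < Pell.xn Nat.one_lt_two (k + 1) := Pell.n_lt_xn Nat.one_lt_two (k + 1)
  have h1 := h 1 3 1 1 (Pell.yn Nat.one_lt_two (k + 1)) (Pell.xn Nat.one_lt_two (k + 1)) one_pos
    (by norm_num) one_pos one_pos hy (by omega) (by have := pell_sq (k + 1); linarith) (by simp)
  have hx' : (k : ℝ) + 1 < (Pell.xn Nat.one_lt_two (k + 1) : ℝ) := by exact_mod_cast hx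
  have hx2 : (Pell.xn Nat.one_lt_two (k + 1) : ℝ) ≤ (Pell.xn Nat.one_lt_two (k + 1) : ℝ) ^ 2 := by
    nlinarith
  push_cast at h1
  simp only [one_mul] at h1
  linarith

/-- **The window of stub B is load-bearing and cannot be weakened to `C ≤ n`**: at `n = 1`, `C = 1`, `C' = 0` the
depth hypothesis holds (`depth_trivial`) while `Flat(1)` fails.  (With `3C < n` the stub is provable bookkeeping,
and even `2C < n` suffices — Disproof.lean (d).) [folklore] -/
theorem not_flatOfDepth_window_le :
    ¬ ∀ n : ℕ, ∀ C C' : ℝ, 0 ≤ C → C ≤ n →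
      (∀ a₁ a₂ c₁ c₂ : ℕ, 0 < a₁ → 0 < a₂ → 0 < c₁ → 0 < c₂ → Nat.Coprime (a₁ * a₂) (c₁ * c₂) →
        a₁ * a₂ ^ n ≠ c₁ * c₂ ^ n → ∀ d : ℕ, 0 < d → (d : ℤ) ∣ ((a₁ * a₂ ^ n : ℕ) : ℤ) - ((c₁ * c₂ ^ n : ℕ) : ℤ) →
        Real.log (d : ℝ) ≤ C * (Real.log ((max a₁ c₁ : ℕ) : ℝ) + Real.log ((max a₂ c₂ : ℕ) : ℝ) +
          Real.log ((UniqueFactorizationMonoid.radical d : ℕ) : ℝ)) + C') →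
      ∃ κ K : ℝ, ∀ u v w X Y Z : ℕ, 0 < u → 0 < v → 0 < w → 0 < X → 0 < Y → 0 < Z →
        u * X ^ n + v * Y ^ n = w * Z ^ n → Nat.Coprime (u * X ^ n) (v * Y ^ n) →
        ((w * Z ^ n : ℕ) : ℝ) ≤ K * ((u * v * w : ℕ) : ℝ) ^ κ := by
  intro h
  exact not_flat_one (h 1 ((1 : ℕ) : ℝ) 0 (Nat.cast_nonneg 1) le_rfl (depth_trivial le_rfl))

/-- **`Flat(0)` is trivially true** (`u + v = w`, so `w ≤ uvw`; `κ = K = 1`). [folklore] -/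
theorem flat_zero :
    ∃ κ K : ℝ, ∀ u v w X Y Z : ℕ, 0 < u → 0 < v → 0 < w → 0 < X → 0 < Y → 0 < Z →
      u * X ^ 0 + v * Y ^ 0 = w * Z ^ 0 → Nat.Coprime (u * X ^ 0) (v * Y ^ 0) →
      ((w * Z ^ 0 : ℕ) : ℝ) ≤ K * ((u * v * w : ℕ) : ℝ) ^ κ := by
  refine ⟨1, 1, fun u v w X Y Z hu hv _ _ _ _ _ _ => ?_⟩
  rw [Real.rpow_one, one_mul, pow_zero, mul_one]
  exact_mod_cast Nat.le_mul_of_pos_left w (Nat.mul_pos hu hv)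

/-- **The level hypothesis `1 ≤ n` of stub C is what keeps it from being the crux in costume**: with it dropped,
`∀ n, Flat(n) → PolyABC` is EQUIVALENT to polynomial abc (hence to the crux, `towerExponentWindow_iff_polyAbc` in
Disproof.lean), because `Flat(0)` holds. [folklore] -/
theorem polyOfFlat_without_level_iff :
    (∀ n : ℕ, (∃ κ K : ℝ, ∀ u v w X Y Z : ℕ, 0 < u → 0 < v → 0 < w → 0 < X → 0 < Y → 0 < Z →
        u * X ^ n + v * Y ^ n = w * Z ^ n → Nat.Coprime (u * X ^ n) (v * Y ^ n) →
        ((w * Z ^ n : ℕ) : ℝ) ≤ K * ((u * v * w : ℕ) : ℝ) ^ κ) →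
      ∃ κ C : ℝ, 0 < C ∧ ∀ a b c : ℕ, IsABCTriple a b c → (c : ℝ) < C * ((rad a b c : ℕ) : ℝ) ^ κ) ↔
    ∃ κ C : ℝ, 0 < C ∧ ∀ a b c : ℕ, IsABCTriple a b c → (c : ℝ) < C * ((rad a b c : ℕ) : ℝ) ^ κ :=
  ⟨fun h => h 0 flat_zero, fun hP _ _ => hP⟩

end Summit.ABC.ABC.Theorems.TowerExponentWindow.Negative
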